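import Mathlib
import HarnessLib
import Summits.HubbardSuperconductivity.HubbardSuperconductivity.Theorems.KLProgrammeKLRegimeSectorMultiplierOverlapWtKernel

/-!
# Route `KLProgramme` — VL child `KLRegimeVolumeLimitV17F2` (stmt-HubbardSuperconductivity-20440), closer MODEL file M2 «MISMATCH-SLICE», bracket (c),
# part 1: the FRAME DEFECT of the re-sectorisation / overlap kernel, `E(F′₁)·S(F₁) − E(F′₂)·S(F₂)` (families of the same two scales on two frames),
# reduces — entry, plain and `klScaleWt`-weighted row / column sums — to character sums of the product-symbol DIFFERENCE `F′₁F₁ − F′₂F₂`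

Cell `gate-hubbard-kl`, seat hubbard-kl-k3c4-p2 (g11; UV / Matsubara all-U lane), ask «MISMATCH-SLICE» (= M2, bracket (c)) of the VL registrant
k3c4-p1 g11 (KL STATUS 2026-08-27 21:51Z / 22:29Z: the object read by `TwoVolumeDefect.sum_pinned_norm_kernel_map_sub_map_le` is the COMPOSITE
position→position re-sectorisation `T_j[K] = ε•E(F_{j+1}[K])·S(F̃_j[K])` of the fine volume at the coarse top frame `K` versus `T_j[K″]` at its own
top frame `K″`; `δ` = plain column sums and pin rows of the difference).  The overlap kernel is LINEAR in the two-multiplier symbol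
(`overlapKernel_eq`, p4), so the difference of two overlap kernels is the "overlap kernel" of the symbol difference `G^Δ = F′₁F₁ − F′₂F₂`, and p4's /
p3's reductions go through verbatim:

* §1 `overlapKernel_sub_apply_of_ne` (vanishes off the `(σ,c)`-diagonal), `overlapKernel_sub_eq`, **`norm_overlapKernel_sub_eq_charSum`**
  (`‖(E₁S₁ − E₂S₂)((y,ℓ′),(x,ℓ))‖ = (βL²)⁻¹·‖Σ_q χ_{q₁}(z₁)χ_{q₂}(z₂) • G^Δ(q)‖` at the displacement);
* §2 **`rowSum_overlapKernel_sub_eq`**, **`colSum_overlapKernel_sub_eq`** (plain position sums `= (βL²)⁻¹·Σ_z ‖S^Δ(z)‖` — the `δ` currency of p572182),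
  **`rowSumWt_overlapKernel_sub_le`**, **`colSumWt_overlapKernel_sub_le`** (tree weight `klScaleWt L M β n`: `≤ (βL²)⁻¹·Σ_z w_n(z)‖S^Δ(z)‖`);
* §3 **`rowSum_wt_overlapKernel_sub_le`**, **`colSum_wt_overlapKernel_sub_le`** — the overlap-count reduction for the difference: with the adjacency
  «`F′₁_{ω′}F₁_ω ≢ 0` or `F′₂_{ω′}F₂_ω ≢ 0`» counted by `novl`, a per-`(ω′,ω,σ,c)` weighted position bound `B` gives the full weighted row sum `≤ novl·B`
  (any weight `W ≥ 0`, in particular `W = 1` and `W = klScaleWt`).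

NOT here: the analytic input (pointwise second differences of the symbol difference `F′[K]F̃[K] − F′[K″]F̃[K″]`, every term carrying the band
increment — the multiplier twin of k3c3-p2's `…SliceSymbolTorusIncrement`).  Proofs only; no definitions; nothing about the model. [folklore]
References: G. Benfatto, A. Giuliani, V. Mastropietro, Ann. Henri Poincaré 7 (2006) 809–898, §2.7 (2.70)–(2.71a); M. Salmhofer, Springer 1999, §4.3.
-/

noncomputable section

namespace Summit.HubbardSuperconductivity.HubbardSuperconductivity.Theorems.TorusFourierL2

set_option linter.dupNamespace false -- summit = problem name (single-conjunct summit), D-0017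

open Finset Complex Literature.Probability.LatticeModels Literature.MathematicalPhysics.QuantumLattice
open Summit.HubbardSuperconductivity.HubbardSuperconductivity.Theorems.KLRegimeSplit
open Summit.HubbardSuperconductivity.HubbardSuperconductivity.Theorems.KLProgrammeLegKernels
open Summit.HubbardSuperconductivity.HubbardSuperconductivity.Theorems.EngineV8
open Summit.HubbardSuperconductivity.HubbardSuperconductivity.Theorems.PerturbedFermiCurve
open scoped Real ComplexConjugate

variable {L M : ℕ} [NeZero L] [NeZero M] {N N' : ℕ}

/-! ## §1 The entries of the overlap defect -/
omit [NeZero M] in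
/-- **Off the `(σ,c)`-diagonal the overlap defect vanishes** (both overlap kernels do). [folklore] -/
theorem overlapKernel_sub_apply_of_ne (β : ℝ) (F'₁ F'₂ : Fin N' → FreqMomentum L M → ℂ) (F₁ F₂ : Fin N → FreqMomentum L M → ℂ)
    (Y' : SpaceTimeIdx L M × SectorLeg N') (Y : SpaceTimeIdx L M × SectorLeg N) (h : ¬ (Y.2.1.2 = Y'.2.1.2 ∧ Y.2.2 = Y'.2.2)) :
    (sectorAnalysisMatrix L M β F'₁ * sectorSubMatrix L M β F₁ - sectorAnalysisMatrix L M β F'₂ * sectorSubMatrix L M β F₂) Y' Y = 0 := by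
  rw [Matrix.sub_apply, sectorAnalysis_mul_sectorSub_apply, sectorAnalysis_mul_sectorSub_apply, if_neg h, if_neg h, sub_zero]

omit [NeZero M] in
/-- **The overlap defect at fixed labels is `(βL²)⁻¹` times a contraction sum of the symbol DIFFERENCE**:
`(E₁S₁ − E₂S₂)((y,(ω′,σ,c)),(x,(ω,σ,c))) = (βL²)⁻¹ Σ_k [pw c k y · conj(pw c k x)] · (F′₁_{ω′}F₁_ω − F′₂_{ω′}F₂_ω)(k)`.
[cite: BenfattoGiulianiMastropietro2006, §2.7 (2.71)] -/
theorem overlapKernel_sub_eq (β : ℝ) (F'₁ F'₂ : Fin N' → FreqMomentum L M → ℂ) (F₁ F₂ : Fin N → FreqMomentum L M → ℂ)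
    (ω' : Fin N') (ω : Fin N) (σ c : Fin 2) (y x : SpaceTimeIdx L M) :
    (sectorAnalysisMatrix L M β F'₁ * sectorSubMatrix L M β F₁ - sectorAnalysisMatrix L M β F'₂ * sectorSubMatrix L M β F₂)
        (y, ((ω', σ), c)) (x, ((ω, σ), c)) =
      ((1 / (β * (L : ℝ) ^ 2) : ℝ) : ℂ) *
        ∑ k : FreqMomentum L M, hubbardPlaneWave L M β c k y * conj (hubbardPlaneWave L M β c k x) *
          (F'₁ ω' k * F₁ ω k - F'₂ ω' k * F₂ ω k) := by
  rw [Matrix.sub_apply, overlapKernel_eq, overlapKernel_eq, ← mul_sub, ← Finset.sum_sub_distrib]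
  refine congrArg _ (Finset.sum_congr rfl fun k _ => ?_)
  ring

/-- **The norm of the overlap defect is `(βL²)⁻¹` times the norm of a product-torus character sum of the symbol difference** at the displacement
`x − y` (charge `0`) resp. `y − x` (charge `1`), `β > 0`. [cite: BenfattoGiulianiMastropietro2006, §2.7 (2.71) and footnote 1] -/
theorem norm_overlapKernel_sub_eq_charSum {β : ℝ} (hβ : 0 < β) (F'₁ F'₂ : Fin N' → FreqMomentum L M → ℂ)
    (F₁ F₂ : Fin N → FreqMomentum L M → ℂ) (ω' : Fin N') (ω : Fin N) (σ c : Fin 2) (y x : SpaceTimeIdx L M) :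
    ‖(sectorAnalysisMatrix L M β F'₁ * sectorSubMatrix L M β F₁ - sectorAnalysisMatrix L M β F'₂ * sectorSubMatrix L M β F₂)
        (y, ((ω', σ), c)) (x, ((ω, σ), c))‖ =
      1 / (β * (L : ℝ) ^ 2) * ‖∑ q : TorusSite 1 (2 * M) × TorusSite 2 L,
          (torusChar q.1 (fun _ : Fin 1 => (((if c = 0 then x else y).1 : ℕ) : ZMod (2 * M)) -
              (((if c = 0 then y else x).1 : ℕ) : ZMod (2 * M))) *
            torusChar q.2 ((if c = 0 then x else y).2 - (if c = 0 then y else x).2)) •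
          (F'₁ ω' (⟨(q.1 0).val, ZMod.val_lt (q.1 0)⟩, q.2) * F₁ ω (⟨(q.1 0).val, ZMod.val_lt (q.1 0)⟩, q.2) -
            F'₂ ω' (⟨(q.1 0).val, ZMod.val_lt (q.1 0)⟩, q.2) * F₂ ω (⟨(q.1 0).val, ZMod.val_lt (q.1 0)⟩, q.2))‖ := by
  have hL : (0 : ℝ) < L := Nat.cast_pos.2 (Nat.pos_of_ne_zero (NeZero.ne L))
  rw [overlapKernel_sub_eq, norm_mul, Complex.norm_real, Real.norm_of_nonneg (by positivity)]
  congr 1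
  fin_cases c
  · simp only [Fin.zero_eta, Fin.isValue, if_true]
    simp_rw [overlapPhase_zero]
    exact norm_sum_conj_hubbardPlaneWave_mul_eq hβ.ne' (fun k => F'₁ ω' k * F₁ ω k - F'₂ ω' k * F₂ ω k) x y
  · simp only [Fin.mk_one, Fin.isValue, show (1 : Fin 2) ≠ 0 by decide, if_false]
    simp_rw [overlapPhase_one]
    exact norm_sum_conj_hubbardPlaneWave_mul_eq hβ.ne' (fun k => F'₁ ω' k * F₁ ω k - F'₂ ω' k * F₂ ω k) y x

/-! ## §2 Position sums of one defect kernel: plain (`δ` currency) and `klScaleWt`-weighted -/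

/-- **Row sum of the overlap defect = `(βL²)⁻¹ ×` the `ℓ¹` norm of the character sum of the symbol difference**: for every `ω′, ω, σ, c` and
every row point `y`. [cite: BenfattoGiulianiMastropietro2006, §2.7 (2.71a)] -/
theorem rowSum_overlapKernel_sub_eq {β : ℝ} (hβ : 0 < β) (F'₁ F'₂ : Fin N' → FreqMomentum L M → ℂ) (F₁ F₂ : Fin N → FreqMomentum L M → ℂ)
    (ω' : Fin N') (ω : Fin N) (σ c : Fin 2) (y : SpaceTimeIdx L M) :
    ∑ x : SpaceTimeIdx L M, ‖(sectorAnalysisMatrix L M β F'₁ * sectorSubMatrix L M β F₁ -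
        sectorAnalysisMatrix L M β F'₂ * sectorSubMatrix L M β F₂) (y, ((ω', σ), c)) (x, ((ω, σ), c))‖ =
      1 / (β * (L : ℝ) ^ 2) * ∑ z : TorusSite 1 (2 * M) × TorusSite 2 L,
        ‖∑ q : TorusSite 1 (2 * M) × TorusSite 2 L, (torusChar q.1 z.1 * torusChar q.2 z.2) •
          (F'₁ ω' (⟨(q.1 0).val, ZMod.val_lt (q.1 0)⟩, q.2) * F₁ ω (⟨(q.1 0).val, ZMod.val_lt (q.1 0)⟩, q.2) -
            F'₂ ω' (⟨(q.1 0).val, ZMod.val_lt (q.1 0)⟩, q.2) * F₂ ω (⟨(q.1 0).val, ZMod.val_lt (q.1 0)⟩, q.2))‖ := by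
  simp_rw [norm_overlapKernel_sub_eq_charSum hβ]
  rw [← Finset.mul_sum]
  congr 1
  fin_cases c
  · simp only [Fin.zero_eta, Fin.isValue, if_true]
    exact sum_spaceTime_eq_sum_prodTorus_fst (fun z : TorusSite 1 (2 * M) × TorusSite 2 L =>
      ‖∑ q : TorusSite 1 (2 * M) × TorusSite 2 L, (torusChar q.1 z.1 * torusChar q.2 z.2) •
        (F'₁ ω' (⟨(q.1 0).val, ZMod.val_lt (q.1 0)⟩, q.2) * F₁ ω (⟨(q.1 0).val, ZMod.val_lt (q.1 0)⟩, q.2) -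
          F'₂ ω' (⟨(q.1 0).val, ZMod.val_lt (q.1 0)⟩, q.2) * F₂ ω (⟨(q.1 0).val, ZMod.val_lt (q.1 0)⟩, q.2))‖) y
  · simp only [Fin.mk_one, Fin.isValue, show (1 : Fin 2) ≠ 0 by decide, if_false]
    exact sum_spaceTime_eq_sum_prodTorus (fun z : TorusSite 1 (2 * M) × TorusSite 2 L =>
      ‖∑ q : TorusSite 1 (2 * M) × TorusSite 2 L, (torusChar q.1 z.1 * torusChar q.2 z.2) •
        (F'₁ ω' (⟨(q.1 0).val, ZMod.val_lt (q.1 0)⟩, q.2) * F₁ ω (⟨(q.1 0).val, ZMod.val_lt (q.1 0)⟩, q.2) -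
          F'₂ ω' (⟨(q.1 0).val, ZMod.val_lt (q.1 0)⟩, q.2) * F₂ ω (⟨(q.1 0).val, ZMod.val_lt (q.1 0)⟩, q.2))‖) y

/-- **Column sum of the overlap defect** (sum over the row point `y` at fixed column point `x`) = the same quantity.
[cite: BenfattoGiulianiMastropietro2006, §2.7 (2.71a)] -/
theorem colSum_overlapKernel_sub_eq {β : ℝ} (hβ : 0 < β) (F'₁ F'₂ : Fin N' → FreqMomentum L M → ℂ) (F₁ F₂ : Fin N → FreqMomentum L M → ℂ)
    (ω' : Fin N') (ω : Fin N) (σ c : Fin 2) (x : SpaceTimeIdx L M) :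
    ∑ y : SpaceTimeIdx L M, ‖(sectorAnalysisMatrix L M β F'₁ * sectorSubMatrix L M β F₁ -
        sectorAnalysisMatrix L M β F'₂ * sectorSubMatrix L M β F₂) (y, ((ω', σ), c)) (x, ((ω, σ), c))‖ =
      1 / (β * (L : ℝ) ^ 2) * ∑ z : TorusSite 1 (2 * M) × TorusSite 2 L,
        ‖∑ q : TorusSite 1 (2 * M) × TorusSite 2 L, (torusChar q.1 z.1 * torusChar q.2 z.2) •
          (F'₁ ω' (⟨(q.1 0).val, ZMod.val_lt (q.1 0)⟩, q.2) * F₁ ω (⟨(q.1 0).val, ZMod.val_lt (q.1 0)⟩, q.2) -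
            F'₂ ω' (⟨(q.1 0).val, ZMod.val_lt (q.1 0)⟩, q.2) * F₂ ω (⟨(q.1 0).val, ZMod.val_lt (q.1 0)⟩, q.2))‖ := by
  simp_rw [norm_overlapKernel_sub_eq_charSum hβ]
  rw [← Finset.mul_sum]
  congr 1
  fin_cases c
  · simp only [Fin.zero_eta, Fin.isValue, if_true]
    exact sum_spaceTime_eq_sum_prodTorus (fun z : TorusSite 1 (2 * M) × TorusSite 2 L =>
      ‖∑ q : TorusSite 1 (2 * M) × TorusSite 2 L, (torusChar q.1 z.1 * torusChar q.2 z.2) •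
        (F'₁ ω' (⟨(q.1 0).val, ZMod.val_lt (q.1 0)⟩, q.2) * F₁ ω (⟨(q.1 0).val, ZMod.val_lt (q.1 0)⟩, q.2) -
          F'₂ ω' (⟨(q.1 0).val, ZMod.val_lt (q.1 0)⟩, q.2) * F₂ ω (⟨(q.1 0).val, ZMod.val_lt (q.1 0)⟩, q.2))‖) x
  · simp only [Fin.mk_one, Fin.isValue, show (1 : Fin 2) ≠ 0 by decide, if_false]
    exact sum_spaceTime_eq_sum_prodTorus_fst (fun z : TorusSite 1 (2 * M) × TorusSite 2 L =>
      ‖∑ q : TorusSite 1 (2 * M) × TorusSite 2 L, (torusChar q.1 z.1 * torusChar q.2 z.2) •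
        (F'₁ ω' (⟨(q.1 0).val, ZMod.val_lt (q.1 0)⟩, q.2) * F₁ ω (⟨(q.1 0).val, ZMod.val_lt (q.1 0)⟩, q.2) -
          F'₂ ω' (⟨(q.1 0).val, ZMod.val_lt (q.1 0)⟩, q.2) * F₂ ω (⟨(q.1 0).val, ZMod.val_lt (q.1 0)⟩, q.2))‖) x

/-- **Weighted row position sum of one defect kernel** (tree weight `klScaleWt L M β n` on the pair of leg positions):
`≤ (βL²)⁻¹·Σ_z w_n(z)‖S^Δ_{ω′ω}(z)‖`, `w_n(z) = 1 + (Λ_nβ/(2M))|z̃₁| + Λ_n|z̃₂⁰| + Λ_n|z̃₂¹|`. [cite: BenfattoGiulianiMastropietro2006, §2.7 (2.71a)] -/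
theorem rowSumWt_overlapKernel_sub_le {β : ℝ} (hβ : 0 < β) (F'₁ F'₂ : Fin N' → FreqMomentum L M → ℂ) (F₁ F₂ : Fin N → FreqMomentum L M → ℂ)
    (n : ℕ) (ω' : Fin N') (ω : Fin N) (σ c : Fin 2) (y : SpaceTimeIdx L M) :
    ∑ x : SpaceTimeIdx L M, ‖(sectorAnalysisMatrix L M β F'₁ * sectorSubMatrix L M β F₁ -
        sectorAnalysisMatrix L M β F'₂ * sectorSubMatrix L M β F₂) (y, ((ω', σ), c)) (x, ((ω, σ), c))‖ *
        klScaleWt L M β n {latticeLegPos (2 * (2 * M)) ((y, ((ω', σ), c)) : SpaceTimeIdx L M × SectorLeg N'),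
          latticeLegPos (2 * (2 * M)) ((x, ((ω, σ), c)) : SpaceTimeIdx L M × SectorLeg N)} ≤
      1 / (β * (L : ℝ) ^ 2) * ∑ z : TorusSite 1 (2 * M) × TorusSite 2 L,
        (1 + klScale klE0 n * β / (2 * M) * |(((z.1 0).valMinAbs : ℤ) : ℝ)| + klScale klE0 n * |(((z.2 0).valMinAbs : ℤ) : ℝ)| +
            klScale klE0 n * |(((z.2 1).valMinAbs : ℤ) : ℝ)|) *
          ‖∑ q : TorusSite 1 (2 * M) × TorusSite 2 L, (torusChar q.1 z.1 * torusChar q.2 z.2) •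
            (F'₁ ω' (⟨(q.1 0).val, ZMod.val_lt (q.1 0)⟩, q.2) * F₁ ω (⟨(q.1 0).val, ZMod.val_lt (q.1 0)⟩, q.2) -
              F'₂ ω' (⟨(q.1 0).val, ZMod.val_lt (q.1 0)⟩, q.2) * F₂ ω (⟨(q.1 0).val, ZMod.val_lt (q.1 0)⟩, q.2))‖ := by
  have hL : (0 : ℝ) < L := Nat.cast_pos.2 (Nat.pos_of_ne_zero (NeZero.ne L))
  have hc0 : 0 ≤ 1 / (β * (L : ℝ) ^ 2) := by positivity
  set h : TorusSite 1 (2 * M) × TorusSite 2 L → ℝ := fun z =>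
    (1 + klScale klE0 n * β / (2 * M) * |(((z.1 0).valMinAbs : ℤ) : ℝ)| + klScale klE0 n * |(((z.2 0).valMinAbs : ℤ) : ℝ)| +
        klScale klE0 n * |(((z.2 1).valMinAbs : ℤ) : ℝ)|) *
      ‖∑ q : TorusSite 1 (2 * M) × TorusSite 2 L, (torusChar q.1 z.1 * torusChar q.2 z.2) •
        (F'₁ ω' (⟨(q.1 0).val, ZMod.val_lt (q.1 0)⟩, q.2) * F₁ ω (⟨(q.1 0).val, ZMod.val_lt (q.1 0)⟩, q.2) -
          F'₂ ω' (⟨(q.1 0).val, ZMod.val_lt (q.1 0)⟩, q.2) * F₂ ω (⟨(q.1 0).val, ZMod.val_lt (q.1 0)⟩, q.2))‖ with hh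
  have hpt : ∀ x : SpaceTimeIdx L M,
      ‖(sectorAnalysisMatrix L M β F'₁ * sectorSubMatrix L M β F₁ - sectorAnalysisMatrix L M β F'₂ * sectorSubMatrix L M β F₂)
          (y, ((ω', σ), c)) (x, ((ω, σ), c))‖ *
        klScaleWt L M β n {latticeLegPos (2 * (2 * M)) ((y, ((ω', σ), c)) : SpaceTimeIdx L M × SectorLeg N'),
          latticeLegPos (2 * (2 * M)) ((x, ((ω, σ), c)) : SpaceTimeIdx L M × SectorLeg N)} ≤
        1 / (β * (L : ℝ) ^ 2) *
          h ((fun _ : Fin 1 => (((if c = 0 then x else y).1 : ℕ) : ZMod (2 * M)) - (((if c = 0 then y else x).1 : ℕ) : ZMod (2 * M))),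
            (if c = 0 then x else y).2 - (if c = 0 then y else x).2) := by
    intro x
    rw [norm_overlapKernel_sub_eq_charSum hβ, hh]
    dsimp only
    rw [mul_assoc]
    refine mul_le_mul_of_nonneg_left ?_ hc0
    rw [mul_comm]
    refine mul_le_mul_of_nonneg_right ?_ (norm_nonneg _)
    have hw := klScaleWt_pair_latticeLegPos_le' (L := L) (M := M) hβ.le n ((y, ((ω', σ), c)) : SpaceTimeIdx L M × SectorLeg N')
      ((x, ((ω, σ), c)) : SpaceTimeIdx L M × SectorLeg N)
    refine hw.trans (le_of_eq ?_)
    fin_cases c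
    · simp only [Fin.zero_eta, Fin.isValue, if_true]
      have e1 : (((x.1 : ℕ) : ZMod (2 * M)) - ((y.1 : ℕ) : ZMod (2 * M))) = -(((y.1 : ℕ) : ZMod (2 * M)) - ((x.1 : ℕ) : ZMod (2 * M))) := by
        ring
      have e2 : ∀ j, (x.2 - y.2) j = -((y.2 - x.2) j) := fun j => by simp
      rw [e1, e2 0, e2 1, abs_valMinAbs_neg_real, abs_valMinAbs_neg_real, abs_valMinAbs_neg_real]
    · simp only [Fin.mk_one, Fin.isValue, show (1 : Fin 2) ≠ 0 by decide, if_false]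
  refine (sum_le_sum fun x _ => hpt x).trans ?_
  rw [← mul_sum]
  refine mul_le_mul_of_nonneg_left (le_of_eq ?_) hc0
  fin_cases c
  · simp only [Fin.zero_eta, Fin.isValue, if_true]
    exact sum_spaceTime_eq_sum_prodTorus_fst h y
  · simp only [Fin.mk_one, Fin.isValue, show (1 : Fin 2) ≠ 0 by decide, if_false]
    exact sum_spaceTime_eq_sum_prodTorus h y

/-- **Weighted column position sum of one defect kernel**: the same bound. [cite: BenfattoGiulianiMastropietro2006, §2.7 (2.71a)] -/
theorem colSumWt_overlapKernel_sub_le {β : ℝ} (hβ : 0 < β) (F'₁ F'₂ : Fin N' → FreqMomentum L M → ℂ) (F₁ F₂ : Fin N → FreqMomentum L M → ℂ)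
    (n : ℕ) (ω' : Fin N') (ω : Fin N) (σ c : Fin 2) (x : SpaceTimeIdx L M) :
    ∑ y : SpaceTimeIdx L M, ‖(sectorAnalysisMatrix L M β F'₁ * sectorSubMatrix L M β F₁ -
        sectorAnalysisMatrix L M β F'₂ * sectorSubMatrix L M β F₂) (y, ((ω', σ), c)) (x, ((ω, σ), c))‖ *
        klScaleWt L M β n {latticeLegPos (2 * (2 * M)) ((y, ((ω', σ), c)) : SpaceTimeIdx L M × SectorLeg N'),
          latticeLegPos (2 * (2 * M)) ((x, ((ω, σ), c)) : SpaceTimeIdx L M × SectorLeg N)} ≤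
      1 / (β * (L : ℝ) ^ 2) * ∑ z : TorusSite 1 (2 * M) × TorusSite 2 L,
        (1 + klScale klE0 n * β / (2 * M) * |(((z.1 0).valMinAbs : ℤ) : ℝ)| + klScale klE0 n * |(((z.2 0).valMinAbs : ℤ) : ℝ)| +
            klScale klE0 n * |(((z.2 1).valMinAbs : ℤ) : ℝ)|) *
          ‖∑ q : TorusSite 1 (2 * M) × TorusSite 2 L, (torusChar q.1 z.1 * torusChar q.2 z.2) •
            (F'₁ ω' (⟨(q.1 0).val, ZMod.val_lt (q.1 0)⟩, q.2) * F₁ ω (⟨(q.1 0).val, ZMod.val_lt (q.1 0)⟩, q.2) -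
              F'₂ ω' (⟨(q.1 0).val, ZMod.val_lt (q.1 0)⟩, q.2) * F₂ ω (⟨(q.1 0).val, ZMod.val_lt (q.1 0)⟩, q.2))‖ := by
  have hL : (0 : ℝ) < L := Nat.cast_pos.2 (Nat.pos_of_ne_zero (NeZero.ne L))
  have hc0 : 0 ≤ 1 / (β * (L : ℝ) ^ 2) := by positivity
  set h : TorusSite 1 (2 * M) × TorusSite 2 L → ℝ := fun z =>
    (1 + klScale klE0 n * β / (2 * M) * |(((z.1 0).valMinAbs : ℤ) : ℝ)| + klScale klE0 n * |(((z.2 0).valMinAbs : ℤ) : ℝ)| +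
        klScale klE0 n * |(((z.2 1).valMinAbs : ℤ) : ℝ)|) *
      ‖∑ q : TorusSite 1 (2 * M) × TorusSite 2 L, (torusChar q.1 z.1 * torusChar q.2 z.2) •
        (F'₁ ω' (⟨(q.1 0).val, ZMod.val_lt (q.1 0)⟩, q.2) * F₁ ω (⟨(q.1 0).val, ZMod.val_lt (q.1 0)⟩, q.2) -
          F'₂ ω' (⟨(q.1 0).val, ZMod.val_lt (q.1 0)⟩, q.2) * F₂ ω (⟨(q.1 0).val, ZMod.val_lt (q.1 0)⟩, q.2))‖ with hh
  have hpt : ∀ y : SpaceTimeIdx L M,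
      ‖(sectorAnalysisMatrix L M β F'₁ * sectorSubMatrix L M β F₁ - sectorAnalysisMatrix L M β F'₂ * sectorSubMatrix L M β F₂)
          (y, ((ω', σ), c)) (x, ((ω, σ), c))‖ *
        klScaleWt L M β n {latticeLegPos (2 * (2 * M)) ((y, ((ω', σ), c)) : SpaceTimeIdx L M × SectorLeg N'),
          latticeLegPos (2 * (2 * M)) ((x, ((ω, σ), c)) : SpaceTimeIdx L M × SectorLeg N)} ≤
        1 / (β * (L : ℝ) ^ 2) *
          h ((fun _ : Fin 1 => (((if c = 0 then x else y).1 : ℕ) : ZMod (2 * M)) - (((if c = 0 then y else x).1 : ℕ) : ZMod (2 * M))),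
            (if c = 0 then x else y).2 - (if c = 0 then y else x).2) := by
    intro y
    rw [norm_overlapKernel_sub_eq_charSum hβ, hh]
    dsimp only
    rw [mul_assoc]
    refine mul_le_mul_of_nonneg_left ?_ hc0
    rw [mul_comm]
    refine mul_le_mul_of_nonneg_right ?_ (norm_nonneg _)
    have hw := klScaleWt_pair_latticeLegPos_le' (L := L) (M := M) hβ.le n ((y, ((ω', σ), c)) : SpaceTimeIdx L M × SectorLeg N')
      ((x, ((ω, σ), c)) : SpaceTimeIdx L M × SectorLeg N)
    refine hw.trans (le_of_eq ?_)
    fin_cases c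
    · simp only [Fin.zero_eta, Fin.isValue, if_true]
      have e1 : (((x.1 : ℕ) : ZMod (2 * M)) - ((y.1 : ℕ) : ZMod (2 * M))) = -(((y.1 : ℕ) : ZMod (2 * M)) - ((x.1 : ℕ) : ZMod (2 * M))) := by
        ring
      have e2 : ∀ j, (x.2 - y.2) j = -((y.2 - x.2) j) := fun j => by simp
      rw [e1, e2 0, e2 1, abs_valMinAbs_neg_real, abs_valMinAbs_neg_real, abs_valMinAbs_neg_real]
    · simp only [Fin.mk_one, Fin.isValue, show (1 : Fin 2) ≠ 0 by decide, if_false]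
  refine (sum_le_sum fun y _ => hpt y).trans ?_
  rw [← mul_sum]
  refine mul_le_mul_of_nonneg_left (le_of_eq ?_) hc0
  fin_cases c
  · simp only [Fin.zero_eta, Fin.isValue, if_true]
    exact sum_spaceTime_eq_sum_prodTorus h x
  · simp only [Fin.mk_one, Fin.isValue, show (1 : Fin 2) ≠ 0 by decide, if_false]
    exact sum_spaceTime_eq_sum_prodTorus_fst h x

/-! ## §3 The overlap-count reduction for the defect (both families' adjacencies) -/
omit [NeZero M] in
/-- Off the joint adjacency the overlap defect vanishes. [folklore] -/
theorem overlapKernel_sub_eq_zero_of_disjoint (β : ℝ) (F'₁ F'₂ : Fin N' → FreqMomentum L M → ℂ) (F₁ F₂ : Fin N → FreqMomentum L M → ℂ)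
    (Y' : SpaceTimeIdx L M × SectorLeg N') (Y : SpaceTimeIdx L M × SectorLeg N)
    (h₁ : ¬ ∃ k, F'₁ Y'.2.1.1 k ≠ 0 ∧ F₁ Y.2.1.1 k ≠ 0) (h₂ : ¬ ∃ k, F'₂ Y'.2.1.1 k ≠ 0 ∧ F₂ Y.2.1.1 k ≠ 0) :
    (sectorAnalysisMatrix L M β F'₁ * sectorSubMatrix L M β F₁ - sectorAnalysisMatrix L M β F'₂ * sectorSubMatrix L M β F₂) Y' Y = 0 := by
  rw [Matrix.sub_apply, sectorAnalysis_mul_sectorSub_eq_zero_of_disjoint β F'₁ F₁ Y' Y h₁,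
    sectorAnalysis_mul_sectorSub_eq_zero_of_disjoint β F'₂ F₂ Y' Y h₂, sub_zero]

open Classical in
omit [NeZero M] in
/-- **Weighted row sum of the defect ≤ joint overlap count × one-kernel weighted size** (any weight `W ≥ 0`): with the joint adjacency
«`∃ k, F′₁_{ω′}(k)F₁_ω(k) ≠ 0` or `∃ k, F′₂_{ω′}(k)F₂_ω(k) ≠ 0`» counted by `novl` at every `ω′`, a per-`(ω′,ω,σ,c)` weighted position bound `B`
gives `Σ_Y ‖(E₁S₁ − E₂S₂) Y′ Y‖·W Y′ Y ≤ novl·B`. [cite: BenfattoGiulianiMastropietro2006, §2.7 (2.71a)] -/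
theorem rowSum_wt_overlapKernel_sub_le (β : ℝ) (F'₁ F'₂ : Fin N' → FreqMomentum L M → ℂ) (F₁ F₂ : Fin N → FreqMomentum L M → ℂ) {novl : ℕ}
    (hovl : ∀ ω' : Fin N', ((Finset.univ : Finset (Fin N)).filter
      (fun ω => (∃ k, F'₁ ω' k ≠ 0 ∧ F₁ ω k ≠ 0) ∨ (∃ k, F'₂ ω' k ≠ 0 ∧ F₂ ω k ≠ 0))).card ≤ novl)
    (W : SpaceTimeIdx L M × SectorLeg N' → SpaceTimeIdx L M × SectorLeg N → ℝ)
    {B : ℝ} (hB0 : 0 ≤ B)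
    (hB : ∀ (ω' : Fin N') (ω : Fin N) (σ c : Fin 2) (y : SpaceTimeIdx L M),
      ∑ x : SpaceTimeIdx L M, ‖(sectorAnalysisMatrix L M β F'₁ * sectorSubMatrix L M β F₁ -
          sectorAnalysisMatrix L M β F'₂ * sectorSubMatrix L M β F₂) (y, ((ω', σ), c)) (x, ((ω, σ), c))‖ *
        W (y, ((ω', σ), c)) (x, ((ω, σ), c)) ≤ B)
    (Y' : SpaceTimeIdx L M × SectorLeg N') :
    ∑ Y, ‖(sectorAnalysisMatrix L M β F'₁ * sectorSubMatrix L M β F₁ - sectorAnalysisMatrix L M β F'₂ * sectorSubMatrix L M β F₂) Y' Y‖ *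
        W Y' Y ≤ novl * B := by
  obtain ⟨y, ⟨ω', σ'⟩, c'⟩ := Y'
  rw [sum_spaceTime_sectorLeg_eq]
  have hvan : ∀ (ω : Fin N) (σ c : Fin 2) (x : SpaceTimeIdx L M), ¬ (σ = σ' ∧ c = c') →
      ‖(sectorAnalysisMatrix L M β F'₁ * sectorSubMatrix L M β F₁ - sectorAnalysisMatrix L M β F'₂ * sectorSubMatrix L M β F₂)
          (y, ((ω', σ'), c')) (x, ((ω, σ), c))‖ * W (y, ((ω', σ'), c')) (x, ((ω, σ), c)) = 0 := by
    intro ω σ c x hne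
    rw [overlapKernel_sub_apply_of_ne β F'₁ F'₂ F₁ F₂ _ _ (by simpa using hne), norm_zero, zero_mul]
  have hω : ∀ ω : Fin N, ∑ σ : Fin 2, ∑ c : Fin 2, ∑ x : SpaceTimeIdx L M,
      ‖(sectorAnalysisMatrix L M β F'₁ * sectorSubMatrix L M β F₁ - sectorAnalysisMatrix L M β F'₂ * sectorSubMatrix L M β F₂)
          (y, ((ω', σ'), c')) (x, ((ω, σ), c))‖ * W (y, ((ω', σ'), c')) (x, ((ω, σ), c)) =
      ∑ x : SpaceTimeIdx L M, ‖(sectorAnalysisMatrix L M β F'₁ * sectorSubMatrix L M β F₁ -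
          sectorAnalysisMatrix L M β F'₂ * sectorSubMatrix L M β F₂) (y, ((ω', σ'), c')) (x, ((ω, σ'), c'))‖ *
        W (y, ((ω', σ'), c')) (x, ((ω, σ'), c')) := by
    intro ω
    rw [Finset.sum_eq_single σ', Finset.sum_eq_single c']
    · intro c _ hc; exact Finset.sum_eq_zero fun x _ => hvan ω σ' c x (by simp [hc])
    · simp
    · intro σ _ hσ; exact Finset.sum_eq_zero fun c _ => Finset.sum_eq_zero fun x _ => hvan ω σ c x (by simp [hσ])
    · simp
  simp_rw [hω]
  set S := (Finset.univ : Finset (Fin N)).filter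
    (fun ω => (∃ k, F'₁ ω' k ≠ 0 ∧ F₁ ω k ≠ 0) ∨ (∃ k, F'₂ ω' k ≠ 0 ∧ F₂ ω k ≠ 0)) with hS
  have hsplit : ∑ ω : Fin N, ∑ x : SpaceTimeIdx L M,
      ‖(sectorAnalysisMatrix L M β F'₁ * sectorSubMatrix L M β F₁ - sectorAnalysisMatrix L M β F'₂ * sectorSubMatrix L M β F₂)
          (y, ((ω', σ'), c')) (x, ((ω, σ'), c'))‖ * W (y, ((ω', σ'), c')) (x, ((ω, σ'), c')) =
      ∑ ω ∈ S, ∑ x : SpaceTimeIdx L M,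
      ‖(sectorAnalysisMatrix L M β F'₁ * sectorSubMatrix L M β F₁ - sectorAnalysisMatrix L M β F'₂ * sectorSubMatrix L M β F₂)
          (y, ((ω', σ'), c')) (x, ((ω, σ'), c'))‖ * W (y, ((ω', σ'), c')) (x, ((ω, σ'), c')) := by
    symm
    refine Finset.sum_subset (Finset.filter_subset _ _) fun ω _ hω => Finset.sum_eq_zero fun x _ => ?_
    rw [hS, Finset.mem_filter, not_and, not_or] at hω
    have h12 := hω (Finset.mem_univ ω)
    rw [overlapKernel_sub_eq_zero_of_disjoint β F'₁ F'₂ F₁ F₂ _ _ h12.1 h12.2, norm_zero, zero_mul]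
  rw [hsplit]
  calc _ ≤ ∑ ω ∈ S, B := Finset.sum_le_sum fun ω _ => hB ω' ω σ' c' y
    _ = S.card * B := by rw [Finset.sum_const, nsmul_eq_mul]
    _ ≤ novl * B := mul_le_mul_of_nonneg_right (by exact_mod_cast hovl ω') hB0

open Classical in
omit [NeZero M] in
/-- **Weighted column sum of the defect ≤ transposed joint overlap count × one-kernel weighted size** (any weight `W ≥ 0`).
[cite: BenfattoGiulianiMastropietro2006, §2.7 (2.71a)] -/
theorem colSum_wt_overlapKernel_sub_le (β : ℝ) (F'₁ F'₂ : Fin N' → FreqMomentum L M → ℂ) (F₁ F₂ : Fin N → FreqMomentum L M → ℂ) {novl' : ℕ}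
    (hovl : ∀ ω : Fin N, ((Finset.univ : Finset (Fin N')).filter
      (fun ω' => (∃ k, F'₁ ω' k ≠ 0 ∧ F₁ ω k ≠ 0) ∨ (∃ k, F'₂ ω' k ≠ 0 ∧ F₂ ω k ≠ 0))).card ≤ novl')
    (W : SpaceTimeIdx L M × SectorLeg N' → SpaceTimeIdx L M × SectorLeg N → ℝ)
    {B' : ℝ} (hB0 : 0 ≤ B')
    (hB : ∀ (ω' : Fin N') (ω : Fin N) (σ c : Fin 2) (x : SpaceTimeIdx L M),
      ∑ y : SpaceTimeIdx L M, ‖(sectorAnalysisMatrix L M β F'₁ * sectorSubMatrix L M β F₁ -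
          sectorAnalysisMatrix L M β F'₂ * sectorSubMatrix L M β F₂) (y, ((ω', σ), c)) (x, ((ω, σ), c))‖ *
        W (y, ((ω', σ), c)) (x, ((ω, σ), c)) ≤ B')
    (Y : SpaceTimeIdx L M × SectorLeg N) :
    ∑ Y', ‖(sectorAnalysisMatrix L M β F'₁ * sectorSubMatrix L M β F₁ - sectorAnalysisMatrix L M β F'₂ * sectorSubMatrix L M β F₂) Y' Y‖ *
        W Y' Y ≤ novl' * B' := by
  obtain ⟨x, ⟨ω, σ⟩, c⟩ := Y
  rw [sum_spaceTime_sectorLeg_eq]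
  have hvan : ∀ (ω' : Fin N') (σ' c' : Fin 2) (y : SpaceTimeIdx L M), ¬ (σ' = σ ∧ c' = c) →
      ‖(sectorAnalysisMatrix L M β F'₁ * sectorSubMatrix L M β F₁ - sectorAnalysisMatrix L M β F'₂ * sectorSubMatrix L M β F₂)
          (y, ((ω', σ'), c')) (x, ((ω, σ), c))‖ * W (y, ((ω', σ'), c')) (x, ((ω, σ), c)) = 0 := by
    intro ω' σ' c' y hne
    rw [overlapKernel_sub_apply_of_ne β F'₁ F'₂ F₁ F₂ _ _ (by
      rintro ⟨h1, h2⟩; exact hne ⟨h1.symm, h2.symm⟩), norm_zero, zero_mul]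
  have hω : ∀ ω' : Fin N', ∑ σ' : Fin 2, ∑ c' : Fin 2, ∑ y : SpaceTimeIdx L M,
      ‖(sectorAnalysisMatrix L M β F'₁ * sectorSubMatrix L M β F₁ - sectorAnalysisMatrix L M β F'₂ * sectorSubMatrix L M β F₂)
          (y, ((ω', σ'), c')) (x, ((ω, σ), c))‖ * W (y, ((ω', σ'), c')) (x, ((ω, σ), c)) =
      ∑ y : SpaceTimeIdx L M, ‖(sectorAnalysisMatrix L M β F'₁ * sectorSubMatrix L M β F₁ -
          sectorAnalysisMatrix L M β F'₂ * sectorSubMatrix L M β F₂) (y, ((ω', σ), c)) (x, ((ω, σ), c))‖ *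
        W (y, ((ω', σ), c)) (x, ((ω, σ), c)) := by
    intro ω'
    rw [Finset.sum_eq_single σ, Finset.sum_eq_single c]
    · intro c' _ hc; exact Finset.sum_eq_zero fun y _ => hvan ω' σ c' y (by simp [hc])
    · simp
    · intro σ' _ hσ; exact Finset.sum_eq_zero fun c' _ => Finset.sum_eq_zero fun y _ => hvan ω' σ' c' y (by simp [hσ])
    · simp
  simp_rw [hω]
  set S := (Finset.univ : Finset (Fin N')).filter
    (fun ω' => (∃ k, F'₁ ω' k ≠ 0 ∧ F₁ ω k ≠ 0) ∨ (∃ k, F'₂ ω' k ≠ 0 ∧ F₂ ω k ≠ 0)) with hS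
  have hsplit : ∑ ω' : Fin N', ∑ y : SpaceTimeIdx L M,
      ‖(sectorAnalysisMatrix L M β F'₁ * sectorSubMatrix L M β F₁ - sectorAnalysisMatrix L M β F'₂ * sectorSubMatrix L M β F₂)
          (y, ((ω', σ), c)) (x, ((ω, σ), c))‖ * W (y, ((ω', σ), c)) (x, ((ω, σ), c)) =
      ∑ ω' ∈ S, ∑ y : SpaceTimeIdx L M,
      ‖(sectorAnalysisMatrix L M β F'₁ * sectorSubMatrix L M β F₁ - sectorAnalysisMatrix L M β F'₂ * sectorSubMatrix L M β F₂)
          (y, ((ω', σ), c)) (x, ((ω, σ), c))‖ * W (y, ((ω', σ), c)) (x, ((ω, σ), c)) := by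
    symm
    refine Finset.sum_subset (Finset.filter_subset _ _) fun ω' _ hω' => Finset.sum_eq_zero fun y _ => ?_
    rw [hS, Finset.mem_filter, not_and, not_or] at hω'
    have h12 := hω' (Finset.mem_univ ω')
    rw [overlapKernel_sub_eq_zero_of_disjoint β F'₁ F'₂ F₁ F₂ _ _ h12.1 h12.2, norm_zero, zero_mul]
  rw [hsplit]
  calc _ ≤ ∑ ω' ∈ S, B' := Finset.sum_le_sum fun ω' _ => hB ω' ω σ c x
    _ = S.card * B' := by rw [Finset.sum_const, nsmul_eq_mul]
    _ ≤ novl' * B' := mul_le_mul_of_nonneg_right (by exact_mod_cast hovl ω) hB0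

open Classical in
omit [NeZero M] in
/-- The joint overlap count is at most the sum of the two one-frame counts (`…FrameSectorOverlap` at each frame). [folklore] -/
theorem card_jointOverlap_le (F'₁ F'₂ : Fin N' → FreqMomentum L M → ℂ) (F₁ F₂ : Fin N → FreqMomentum L M → ℂ) (ω' : Fin N')
    {n₁ n₂ : ℕ} (h₁ : ((Finset.univ : Finset (Fin N)).filter (fun ω => ∃ k, F'₁ ω' k ≠ 0 ∧ F₁ ω k ≠ 0)).card ≤ n₁)
    (h₂ : ((Finset.univ : Finset (Fin N)).filter (fun ω => ∃ k, F'₂ ω' k ≠ 0 ∧ F₂ ω k ≠ 0)).card ≤ n₂) :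
    ((Finset.univ : Finset (Fin N)).filter
      (fun ω => (∃ k, F'₁ ω' k ≠ 0 ∧ F₁ ω k ≠ 0) ∨ (∃ k, F'₂ ω' k ≠ 0 ∧ F₂ ω k ≠ 0))).card ≤ n₁ + n₂ := by
  rw [Finset.filter_or]
  exact (Finset.card_union_le _ _).trans (add_le_add h₁ h₂)

open Classical in
omit [NeZero M] in
/-- The transposed joint overlap count (first slot varying). [folklore] -/
theorem card_jointOverlap_le' (F'₁ F'₂ : Fin N' → FreqMomentum L M → ℂ) (F₁ F₂ : Fin N → FreqMomentum L M → ℂ) (ω : Fin N)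
    {n₁ n₂ : ℕ} (h₁ : ((Finset.univ : Finset (Fin N')).filter (fun ω' => ∃ k, F'₁ ω' k ≠ 0 ∧ F₁ ω k ≠ 0)).card ≤ n₁)
    (h₂ : ((Finset.univ : Finset (Fin N')).filter (fun ω' => ∃ k, F'₂ ω' k ≠ 0 ∧ F₂ ω k ≠ 0)).card ≤ n₂) :
    ((Finset.univ : Finset (Fin N')).filter
      (fun ω' => (∃ k, F'₁ ω' k ≠ 0 ∧ F₁ ω k ≠ 0) ∨ (∃ k, F'₂ ω' k ≠ 0 ∧ F₂ ω k ≠ 0))).card ≤ n₁ + n₂ := by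
  rw [Finset.filter_or]
  exact (Finset.card_union_le _ _).trans (add_le_add h₁ h₂)

end Summit.HubbardSuperconductivity.HubbardSuperconductivity.Theorems.TorusFourierL2

end
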